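import Mathlib.MeasureTheory.Measure.Lebesgue.Basic
import Mathlib.MeasureTheory.Measure.Real
import Mathlib.Algebra.Order.Floor.Semiring
import Mathlib.Algebra.Order.BigOperators.Group.Finset
import Mathlib.Tactic.FieldSimp
import Mathlib.Tactic.GCongr
import Mathlib.Tactic.Linarith
import Mathlib.Tactic.Positivity
import Mathlib.Tactic.Ring
import HarnessLib

/-!
# Lattice-point counting on a line (towards Yoshinaga's theorem, arXiv:0805.0349, §3.4–3.6)

Yoshinaga, *Periods and elementary real numbers* (2008), §3.4–3.6, proves that the volume of a
bounded semialgebraic set `D ⊆ [0, r]^ℓ` is an elementary real number by comparing `vol(D)` with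
Riemann sums over the cubes of mesh `r/n` (Lemma 26: the Riemann sums are elementary; Lemma 29:
`|vol(D) - vol(V_n)| < 1/k` for `4 r L √ℓ k < n`, the constant `L = L(D)` coming from the
Minkowski content of `∂D`, Prop. 28).  The tree proves the same statement by a variant in which
the cubes *contained in* `D` are replaced by the lattice *points* of `((1/N)ℤ - r)^m` lying in
`D`, and the Minkowski-content estimate of Lemma 29 is replaced by an induction over coordinates
whose one-dimensional step is this file:

* `Yoshinaga.abs_volumeReal_sub_card_div_le` — if `L ⊆ [-r, r)` is measurable and membership in
  `L` is constant along every segment `[t₁, t₂]` avoiding a finite set `Z` (for a semialgebraic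
  set: the real roots of the defining polynomials restricted to the line), then the length of `L`
  differs from `(1/N) · #{j < 2rN | j/N - r ∈ L}` by at most `#Z / N`: only the `≤ #Z` cells
  `[j/N - r, (j+1)/N - r)` meeting `Z` contribute, each by at most `1/N`.

Notation fixed here and used by the sequel files (`YoshinagaSignCells`, `YoshinagaLatticeDiscrepancy`,
`YoshinagaLatticeCount`, `YoshinagaBoundedVolume`): `Yoshinaga.latticeCoord r N j = j/N - r`
and the cells `Yoshinaga.cell r N j = [latticeCoord j, latticeCoord (j+1))`, which partition
`[-r, r)` for `j < 2 r N`.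

## References

* M. Yoshinaga, *Periods and elementary real numbers*, arXiv:0805.0349 (2008), §3.4 (Riemann
  sums, Lemma 26), §3.6 (Lemma 29).
-/

noncomputable section

open scoped Classical
open MeasureTheory Set Finset

namespace Literature.NumberTheory.Transcendental

namespace Yoshinaga

/-! ### The lattice `(1/N)ℤ - r` on the line and its cells -/

/-- The `j`-th lattice abscissa of mesh `1/N` on `[-r, r)`: `j / N - r`
(Yoshinaga 2008, §3.4: the vertices `k r / n` of the cubes `C_n(k)`, here translated to a box
centred at the origin). [cite: Yoshinaga2008, §3.4] -/
def latticeCoord (r N j : ℕ) : ℝ := (j : ℝ) / N - r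

/-- The `j`-th half-open cell `[j/N - r, (j+1)/N - r)` of the lattice of mesh `1/N`
(the one-dimensional trace of Yoshinaga's cubes `C_n(k)`). [cite: Yoshinaga2008, §3.4] -/
def cell (r N j : ℕ) : Set ℝ := Ico (latticeCoord r N j) (latticeCoord r N (j + 1))

variable {r N : ℕ}

/-- `latticeCoord r N 0 = -r`. [folklore] -/
@[simp] theorem latticeCoord_zero : latticeCoord r N 0 = -(r : ℝ) := by
  simp [latticeCoord]

/-- Consecutive lattice abscissae differ by the mesh `1/N`. [folklore] -/
theorem latticeCoord_succ (hN : 0 < N) (j : ℕ) :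
    latticeCoord r N (j + 1) = latticeCoord r N j + 1 / N := by
  have hN' : (N : ℝ) ≠ 0 := by exact_mod_cast hN.ne'
  simp only [latticeCoord, Nat.cast_add, Nat.cast_one]
  field_simp
  ring

/-- The last lattice abscissa is `r`. [folklore] -/
theorem latticeCoord_two_mul (hN : 0 < N) : latticeCoord r N (2 * r * N) = r := by
  have hN' : (N : ℝ) ≠ 0 := by exact_mod_cast hN.ne'
  simp only [latticeCoord, Nat.cast_mul, Nat.cast_ofNat]
  field_simp
  ring

/-- The lattice abscissae increase with `j`. [folklore] -/
theorem latticeCoord_mono (hN : 0 < N) {j j' : ℕ} (h : j ≤ j') :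
    latticeCoord r N j ≤ latticeCoord r N j' := by
  have hN' : (0 : ℝ) < N := by exact_mod_cast hN
  simp only [latticeCoord]
  gcongr

/-- The cells have length `1/N`. [folklore] -/
theorem volumeReal_cell (hN : 0 < N) (j : ℕ) : volume.real (cell r N j) = 1 / N := by
  rw [cell, latticeCoord_succ hN, Real.volume_real_Ico_of_le (by simp)]
  ring

/-- A point of the `j`-th cell has lattice index `⌊(z + r) N⌋ = j`. [folklore] -/
theorem floor_eq_of_mem_cell (hN : 0 < N) {j : ℕ} {z : ℝ} (hz : z ∈ cell r N j) :
    ⌊(z + r) * N⌋₊ = j := by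
  have hN' : (0 : ℝ) < N := by exact_mod_cast hN
  simp only [cell, latticeCoord, Set.mem_Ico, Nat.cast_add, Nat.cast_one] at hz
  obtain ⟨h1, h2⟩ := hz
  have h1' : (j : ℝ) ≤ (z + r) * N := by
    have := mul_le_mul_of_nonneg_right h1 hN'.le
    rwa [sub_mul, div_mul_cancel₀ _ hN'.ne', sub_le_iff_le_add, ← add_mul] at this
  have h2' : (z + r) * N < j + 1 := by
    have := mul_lt_mul_of_pos_right h2 hN'
    rwa [sub_mul, div_mul_cancel₀ _ hN'.ne', lt_sub_iff_add_lt, ← add_mul] at this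
  have h0 : 0 ≤ (z + r) * N := le_trans (Nat.cast_nonneg j) h1'
  exact (Nat.floor_eq_iff h0).2 ⟨h1', h2'⟩

/-- Every point of `[-r, r)` lies in the cell of index `⌊(t + r) N⌋ < 2 r N`. [folklore] -/
theorem mem_cell_floor (hN : 0 < N) {t : ℝ} (ht : t ∈ Ico (-(r : ℝ)) r) :
    ⌊(t + r) * N⌋₊ < 2 * r * N ∧ t ∈ cell r N ⌊(t + r) * N⌋₊ := by
  have hN' : (0 : ℝ) < N := by exact_mod_cast hN
  obtain ⟨h1, h2⟩ := ht
  have h0 : 0 ≤ (t + r) * N := mul_nonneg (by linarith) hN'.le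
  refine ⟨?_, ?_, ?_⟩
  · refine (Nat.floor_lt h0).2 ?_
    have : (t + r) * N < (2 * r : ℝ) * N := mul_lt_mul_of_pos_right (by linarith) hN'
    exact_mod_cast this
  · simp only [latticeCoord]
    rw [sub_le_iff_le_add, div_le_iff₀ hN']
    exact Nat.floor_le h0
  · simp only [latticeCoord, Nat.cast_add, Nat.cast_one]
    rw [lt_sub_iff_add_lt, lt_div_iff₀ hN']
    exact Nat.lt_floor_add_one _

/-- Distinct cells are disjoint. [folklore] -/
theorem disjoint_cell (hN : 0 < N) {j j' : ℕ} (h : j ≠ j') : Disjoint (cell r N j) (cell r N j') := by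
  wlog hlt : j < j' generalizing j j'
  · exact (this h.symm (lt_of_le_of_ne (not_lt.1 hlt) h.symm)).symm
  rw [Set.disjoint_left]
  intro t ht ht'
  have h1 : latticeCoord r N (j + 1) ≤ latticeCoord r N j' := latticeCoord_mono hN hlt
  exact (not_lt.2 (h1.trans ht'.1)) ht.2

/-- The cells `j < 2 r N` cover `[-r, r)`. [folklore] -/
theorem biUnion_cell_eq (hN : 0 < N) :
    (⋃ j ∈ Finset.range (2 * r * N), cell r N j) = Ico (-(r : ℝ)) r := by
  ext t
  simp only [mem_iUnion, Finset.mem_range, exists_prop]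
  constructor
  · rintro ⟨j, hj, ht⟩
    refine ⟨?_, ?_⟩
    · have : latticeCoord r N 0 ≤ latticeCoord r N j := latticeCoord_mono hN (Nat.zero_le j)
      rw [latticeCoord_zero] at this
      exact this.trans ht.1
    · have : latticeCoord r N (j + 1) ≤ latticeCoord r N (2 * r * N) :=
        latticeCoord_mono hN (Nat.succ_le_of_lt hj)
      rw [latticeCoord_two_mul hN] at this
      exact lt_of_lt_of_le ht.2 this
  · intro ht
    exact ⟨_, (mem_cell_floor hN ht).1, (mem_cell_floor hN ht).2⟩

/-- The cells are measurable. [folklore] -/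
theorem measurableSet_cell (j : ℕ) : MeasurableSet (cell r N j) := measurableSet_Ico

/-! ### The one-dimensional counting lemma -/

/-- On a cell avoiding the exceptional set `Z`, membership in `L` is decided at the left endpoint.
[folklore] -/
theorem inter_cell_eq_of_forall_not_mem {L : Set ℝ} {Z : Finset ℝ}
    (hconst : ∀ t₁ t₂ : ℝ, t₁ ≤ t₂ → (∀ z ∈ Z, z ∉ Icc t₁ t₂) → (t₁ ∈ L ↔ t₂ ∈ L)) {j : ℕ}
    (hj : ∀ z ∈ Z, z ∉ cell r N j) :
    L ∩ cell r N j = if latticeCoord r N j ∈ L then cell r N j else ∅ := by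
  have key : ∀ t ∈ cell r N j, (latticeCoord r N j ∈ L ↔ t ∈ L) := by
    intro t ht
    refine hconst _ _ ht.1 fun z hz hzI => hj z hz ⟨hzI.1, lt_of_le_of_lt hzI.2 ht.2⟩
  split_ifs with h
  · ext t
    simp only [mem_inter_iff, and_iff_right_iff_imp]
    exact fun ht => (key t ht).1 h
  · ext t
    simp only [mem_inter_iff, mem_empty_iff_false, iff_false, not_and]
    exact fun htL ht => h ((key t ht).2 htL)

/-- Cellwise error: the length of `L` inside one cell differs from the contribution
`[j/N - r ∈ L] / N` of its left endpoint by at most `1/N`, and not at all if the cell avoids `Z`.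
[folklore] -/
theorem abs_volumeReal_inter_cell_sub_le (hN : 0 < N) {L : Set ℝ} {Z : Finset ℝ}
    (hconst : ∀ t₁ t₂ : ℝ, t₁ ≤ t₂ → (∀ z ∈ Z, z ∉ Icc t₁ t₂) → (t₁ ∈ L ↔ t₂ ∈ L)) (j : ℕ) :
    |volume.real (L ∩ cell r N j) - (if latticeCoord r N j ∈ L then (1 : ℝ) / N else 0)| ≤
      if ∃ z ∈ Z, z ∈ cell r N j then (1 : ℝ) / N else 0 := by
  by_cases hbad : ∃ z ∈ Z, z ∈ cell r N j
  · rw [if_pos hbad]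
    have h0 : 0 ≤ volume.real (L ∩ cell r N j) := measureReal_nonneg
    have h1 : volume.real (L ∩ cell r N j) ≤ 1 / N := by
      rw [← volumeReal_cell (r := r) hN j]
      exact measureReal_mono inter_subset_right (by simp [cell, Real.volume_Ico])
    have hN' : (0 : ℝ) ≤ 1 / N := by positivity
    rw [abs_le]
    split_ifs <;> constructor <;> linarith
  · rw [if_neg hbad]
    simp only [not_exists, not_and] at hbad
    rw [inter_cell_eq_of_forall_not_mem hconst hbad]
    split_ifs with h
    · rw [volumeReal_cell hN, sub_self, abs_zero]
    · simp

/-- The indices of the cells meeting `Z` number at most `#Z`. [folklore] -/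
theorem card_filter_exists_mem_cell_le (hN : 0 < N) (Z : Finset ℝ) (s : Finset ℕ) :
    (s.filter fun j => ∃ z ∈ Z, z ∈ cell r N j).card ≤ Z.card := by
  calc (s.filter fun j => ∃ z ∈ Z, z ∈ cell r N j).card
      ≤ (Z.image fun z : ℝ => ⌊(z + r) * N⌋₊).card := by
        refine Finset.card_le_card fun j hj => ?_
        obtain ⟨z, hz, hzj⟩ := (Finset.mem_filter.1 hj).2
        exact Finset.mem_image.2 ⟨z, hz, floor_eq_of_mem_cell hN hzj⟩
    _ ≤ Z.card := Finset.card_image_le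

/-- **One-dimensional counting lemma.** Let `L ⊆ [-r, r)` be measurable and suppose membership in
`L` is constant along every segment `[t₁, t₂]` containing no point of the finite set `Z`. Then the
length of `L` and the normalised number of lattice points `j/N - r` (`j < 2rN`) in `L` differ by at
most `#Z / N`. (Replaces, in dimension one, the Minkowski-content estimate of Yoshinaga 2008,
Lemma 29; for semialgebraic `L`, `Z` is the set of real roots on the line of the defining
polynomials, cf. Lemma 26.) [folklore] -/
theorem abs_volumeReal_sub_card_div_le (hN : 0 < N) {L : Set ℝ} (hL : MeasurableSet L)
    (hLsub : L ⊆ Ico (-(r : ℝ)) r) (Z : Finset ℝ)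
    (hconst : ∀ t₁ t₂ : ℝ, t₁ ≤ t₂ → (∀ z ∈ Z, z ∉ Icc t₁ t₂) → (t₁ ∈ L ↔ t₂ ∈ L)) :
    |volume.real L -
        (((Finset.range (2 * r * N)).filter fun j => latticeCoord r N j ∈ L).card : ℝ) / N| ≤
      Z.card / N := by
  set B := 2 * r * N with hB
  have hvol : volume.real L = ∑ j ∈ Finset.range B, volume.real (L ∩ cell r N j) := by
    have hLeq : L = ⋃ j ∈ Finset.range B, (L ∩ cell r N j) := by
      rw [← inter_iUnion₂, biUnion_cell_eq hN, inter_eq_left.2 hLsub]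
    conv_lhs => rw [hLeq]
    refine measureReal_biUnion_finset ?_ (fun j _ => hL.inter (measurableSet_cell j)) ?_
    · intro j _ j' _ hjj'
      exact (disjoint_cell hN hjj').mono inter_subset_right inter_subset_right
    · intro j _
      refine ne_top_of_le_ne_top ?_ (measure_mono inter_subset_right)
      simp [cell, Real.volume_Ico]
  have hcount : (((Finset.range B).filter fun j => latticeCoord r N j ∈ L).card : ℝ) / N =
      ∑ j ∈ Finset.range B, (if latticeCoord r N j ∈ L then (1 : ℝ) / N else 0) := by
    rw [Finset.sum_ite, Finset.sum_const_zero, add_zero, Finset.sum_const, nsmul_eq_mul]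
    ring
  rw [hvol, hcount, ← Finset.sum_sub_distrib]
  refine (Finset.abs_sum_le_sum_abs _ _).trans ?_
  calc ∑ j ∈ Finset.range B, |volume.real (L ∩ cell r N j) -
          (if latticeCoord r N j ∈ L then (1 : ℝ) / N else 0)|
      ≤ ∑ j ∈ Finset.range B, (if ∃ z ∈ Z, z ∈ cell r N j then (1 : ℝ) / N else 0) :=
        Finset.sum_le_sum fun j _ => abs_volumeReal_inter_cell_sub_le hN hconst j
    _ = ((Finset.range B).filter fun j => ∃ z ∈ Z, z ∈ cell r N j).card * ((1 : ℝ) / N) := by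
        rw [Finset.sum_ite, Finset.sum_const_zero, add_zero, Finset.sum_const, nsmul_eq_mul]
    _ ≤ Z.card * ((1 : ℝ) / N) := by
        gcongr
        exact card_filter_exists_mem_cell_le hN Z _
    _ = Z.card / N := by ring

end Yoshinaga

end Literature.NumberTheory.Transcendental
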